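import Summits.BirchSwinnertonDyer.BirchSwinnertonDyer.Theorems.KatoDescentTamePotSupersingularTameUpperOpenRowCertificates
import Literature.NumberTheory.NumberFields.ClassGroupRankEqualityCyclotomicTowerLeaf
import Literature.NumberTheory.EllipticCurves.IwasawaCyclotomicProofs
import Literature.NumberTheory.EllipticCurves.FineSelmerClassGroupCriterionThm34Proofs
import HarnessLib

/-!
# Route `KatoDescentTamePotSupersingular` (rung K8, sub-rung B4 (t′), cell `bsd-potss`): the U₀-ns row `396900b1` @ `p = 5` BY THE μ-ROAD
# WITH THE RANK-EQUALITY TRANSFER — `μ_5(ℚ(P)) = 0` (degree 24, numerically out of reach) READ ON `ℚ(x(P))` (degree 12)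

Seat `bsd-potss-k8t-c4` g25; `--supports stmt-BirchSwinnertonDyer-19982 --as helper`. THEOREMS ONLY (no definition, no named fact, no `sorry`);
PER ROW; nothing booked; (A), Conjecture A and BSD are proved for NO curve here; items 19202 / 19982 stay OPEN at class level (open inputs: zeta
crux 24439, lower half of 19984).

WHAT IS NEW. The tree's `5Nn` door `CartanMuRoadDoorsTprimeFive.missingUpperBoundAt_five_tame_of_nonsplitCartanBasis_of_mu` closes U₀ at a (t′) row
with mod-5 image `C_ns⁺(5)` from SEVEN classical `μ = 0` hypotheses, one per leaf `ℚ(E[5])^H`; for `396900b1` six of them concern fields of degree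
`≤ 12` and the seventh is `ℚ(P) = ℚ(E[5])^{⟨σ̄_s⟩}` of degree 24, whose first cyclotomic layer has degree 120 — no class-group computation
certifies it. This file replaces that seventh hypothesis by the RANK-EQUALITY TRANSFER (equivariant form of Iwasawa's rank lemma, tree
`RankEqualityTransfer.classicalMuVanishes_of_isCyclotomic_fixedField_of_saturated`, k8t-c4 g25, over the cyclotomic `ℤ_5`-extension of `ℚ`): if `rank_5 Cl(ℚ(P)) = rank_5 Cl(ℚ(x(P)))`
(`hrank`; numerically `1 = 1`: `h(ℚ(x(P))) = 30` certified, `h(ℚ(P)) = 60` under GRH, kit j332102) and `σ̄_x¹² = −1` lies in the inertia group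
of every prime of `ℚ(E[5])` above `5` (`hcI`; here `e(𝔮|5) = 8` for the three primes above 5, kit j332102, and every subgroup of `C_ns⁺(5)` of
order divisible by 4 contains `−1`), then `μ_5 = 0` for the cyclotomic `ℤ_5`-extension of `ℚ(x(P))` implies the same for `ℚ(P)`.  So the
record below displays SIX `μ`-hypotheses (leaves of degrees 12, 12, 6, 6, 6, 3 — the degree `≤ 6` ones certified by the one-layer small-rank
criterion, memo `MEMO-iso-396900b1-k8t-c4-g25.md` §4; the two degree-12 ones = kit j331691, layer-1 fields of degree 60) plus `hrank`, `hcI`,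
the basis data of the image and the named facts `hKatoA hGZK hmod` (Coates–Sujatha Thm. 3.4 is the tree theorem `CoatesSujatha2005.thm34_…_holds`).
KERNEL (imported from `TameConjAFiveRecords`): `Δ ≠ 0`, global minimality, `E[5]` irreducible, `Addv E 5`, `SubTprime E 5`; and HERE: `5 ∤ [ℚ(E[5]) : ℚ]`
and the centrality of `σ̄_x¹²` from the basis data (`R_ε¹² = −1`, orders in `C_ns⁺(ε)` divide 24, by `decide`).

References: [Kato2004Asterisque] Thm. 14.5 (3); [CoatesSujatha2005] Thm. 3.4; [Washington1997] §13.1, §13.3 Prop. 13.23; [Serre1972] §2.2;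
[Lemmermeyer1994] §1; [Cremona2006] Table 1.
-/

set_option autoImplicit false
set_option linter.dupNamespace false

noncomputable section

open scoped Classical NumberField Matrix
open WeierstrassCurve Field IntermediateField
  Literature.NumberTheory.EllipticCurves Literature.NumberTheory.EllipticCurves.Rank1Residual
  Literature.NumberTheory.EllipticCurves.Rank1Residual.Typed
  Literature.NumberTheory.GaloisRepresentations Literature.NumberTheory.SerreUniformity
  Literature.NumberTheory.IwasawaTheory
  Literature.NumberTheory.NumberFields
  Summit.BirchSwinnertonDyer.Rank1Residual Summit.BirchSwinnertonDyer.Rank1Residual.Additive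
  Summit.BirchSwinnertonDyer.BirchSwinnertonDyer.Theorems

namespace Summit.BirchSwinnertonDyer.BirchSwinnertonDyer.Theorems.TameRankEqRecords

/-! ### §0 Finite facts about `C_ns⁺(ε) ⊂ GL₂(𝔽₅)`, `ε ∈ {2, 3}`, by `decide` -/

/-- Orders in `C_ns(2) ≅ 𝔽₂₅ˣ` divide `24`. [folklore] -/
private theorem c2_pow' : ∀ a b : ZMod 5, (a, b) ≠ (0, 0) →
    ((!![a, 2 * b; b, a] : Matrix (Fin 2) (Fin 2) (ZMod 5)) ^ 8) ^ 3 = 1 := by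
  decide

/-- Orders in `C_ns(3) ≅ 𝔽₂₅ˣ` divide `24`. [folklore] -/
private theorem c3_pow' : ∀ a b : ZMod 5, (a, b) ≠ (0, 0) →
    ((!![a, 3 * b; b, a] : Matrix (Fin 2) (Fin 2) (ZMod 5)) ^ 8) ^ 3 = 1 := by
  decide

/-- Orders in `C_ns⁺(2) ∖ C_ns(2)` divide `8`. [folklore] -/
private theorem n2_pow' : ∀ a b : ZMod 5, (a, b) ≠ (0, 0) →
    ((!![a, -(2 * b); b, -a] : Matrix (Fin 2) (Fin 2) (ZMod 5))) ^ 8 = 1 := by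
  decide

/-- Orders in `C_ns⁺(3) ∖ C_ns(3)` divide `8`. [folklore] -/
private theorem n3_pow' : ∀ a b : ZMod 5, (a, b) ≠ (0, 0) →
    ((!![a, -(3 * b); b, -a] : Matrix (Fin 2) (Fin 2) (ZMod 5))) ^ 8 = 1 := by
  decide

/-- The non-squares of `𝔽₅` are `2` and `3`. [folklore] -/
private theorem eq_two_or_three_of_not_isSquare' {ε : ZMod 5} (hε : ¬ IsSquare ε) : ε = 2 ∨ ε = 3 := by
  have key : ∀ e : ZMod 5, e = 0 ∨ e = 1 ∨ e = 4 ∨ e = 2 ∨ e = 3 := by decide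
  rcases key ε with h | h | h | h | h
  · exact absurd ⟨0, by rw [h, mul_zero]⟩ hε
  · exact absurd ⟨1, by rw [h, mul_one]⟩ hε
  · exact absurd ⟨2, by rw [h]; decide⟩ hε
  · exact Or.inl h
  · exact Or.inr h

/-- Every element of `C_ns⁺(ε)`, `ε ∈ {2, 3}`, has order dividing `24`. [folklore] -/
private theorem pow_24_eq_one_of_mem' {ε : ZMod 5} (hε : ε = 2 ∨ ε = 3) {A : Matrix (Fin 2) (Fin 2) (ZMod 5)}
    (hA : A ∈ nonsplitCartanNormalizer ε) : A ^ 24 = 1 := by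
  obtain ⟨a, b, hab, rfl | rfl⟩ := hA
  · rw [show (24 : ℕ) = 8 * 3 by norm_num, pow_mul]
    rcases hε with rfl | rfl
    exacts [c2_pow' a b hab, c3_pow' a b hab]
  · rw [show (24 : ℕ) = 8 * 3 by norm_num, pow_mul]
    rcases hε with rfl | rfl
    · rw [n2_pow' a b hab, one_pow]
    · rw [n3_pow' a b hab, one_pow]

/-- `R_ε¹² = −1` for the generator `R_ε = (1 ε(4−ε); 4−ε 1)` of `C_ns(ε)`, `ε ∈ {2, 3}`. [folklore] -/
private theorem R_pow_twelve {ε : ZMod 5} (hε : ε = 2 ∨ ε = 3) :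
    (!![1, ε * (4 - ε); 4 - ε, 1] : Matrix (Fin 2) (Fin 2) (ZMod 5)) ^ 12 = -1 := by
  rcases hε with rfl | rfl <;> decide

/-- Two matrices acting alike on all `e P` coincide (`e` onto). [folklore] -/
private theorem matrix_eq_of_forall_mulVec' {A : Type*} [AddCommGroup A] {n : ℕ} (e : A ≃+ (Fin 2 → ZMod n))
    {M N : Matrix (Fin 2) (Fin 2) (ZMod n)} (h : ∀ P : A, M *ᵥ e P = N *ᵥ e P) : M = N := by
  have h' : ∀ v, M *ᵥ v = N *ᵥ v := fun v => by simpa using h (e.symm v)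
  ext i j
  have := congrFun (h' (Pi.single j 1)) i
  simpa [Matrix.mulVec_single] using this

/-- Restriction `Γ_F → Gal(E/F)` is onto. [folklore] -/
private theorem absRestrictNormalHom_surjective' {F : Type} [Field F] (E : IntermediateField F (AlgebraicClosure F))
    [Normal F E] : Function.Surjective (absRestrictNormalHom E) := fun g => by
  obtain ⟨σ, hσ⟩ := AlgEquiv.restrictNormalHom_surjective (AlgebraicClosure F) g
  exact ⟨(Field.absoluteGaloisGroup.toAlgEquiv F).symm σ, hσ⟩

/-- `⟨c⟩ ⊔ H = {cᵐ h}` for `c` central. [folklore] -/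
private theorem exists_zpow_mul_of_mem_zpowers_sup' {G : Type*} [Group G] (c : G) (hc : ∀ g : G, g * c = c * g)
    (H : Subgroup G) {h' : G} (hh' : h' ∈ Subgroup.zpowers c ⊔ H) : ∃ m : ℤ, ∃ h ∈ H, h' = c ^ m * h := by
  haveI : (Subgroup.zpowers c).Normal := by
    refine ⟨fun a ha g => ?_⟩
    obtain ⟨m, rfl⟩ := Subgroup.mem_zpowers_iff.mp ha
    have hcomm : g * c ^ m = c ^ m * g := (((commute_iff_eq c g).mpr (hc g).symm).zpow_left m).eq.symm
    rw [hcomm, mul_inv_cancel_right]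
    exact ⟨m, rfl⟩
  have h1 : h' ∈ ((Subgroup.zpowers c ⊔ H : Subgroup G) : Set G) := hh'
  rw [Subgroup.normal_mul] at h1
  obtain ⟨i, hi, h, hh, rfl⟩ := Set.mem_mul.mp h1
  obtain ⟨m, rfl⟩ := Subgroup.mem_zpowers_iff.mp hi
  exact ⟨m, h, hh, rfl⟩

/-- `p ∤ [L : k]` when every element of `Gal(L/k)` has order dividing `24` and `p ∤ 24`. [folklore] -/
private theorem not_dvd_finrank_of_forall_pow_24 {k : Type} [Field k] (L : IntermediateField k (AlgebraicClosure k))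
    [FiniteDimensional k L] [IsGalois k L] {p : ℕ} (hp : p.Prime) (hp24 : ¬ p ∣ 24)
    (h24 : ∀ g : L ≃ₐ[k] L, g ^ 24 = 1) : ¬ p ∣ Module.finrank k L := by
  classical
  haveI : Fact p.Prime := ⟨hp⟩
  intro h5
  rw [← IsGalois.card_aut_eq_finrank, Nat.card_eq_fintype_card] at h5
  obtain ⟨g, hg⟩ := exists_prime_orderOf_dvd_card p h5
  have h1 : orderOf g ∣ 24 := orderOf_dvd_of_pow_eq_one (h24 g)
  rw [hg] at h1
  exact hp24 h1

/-- `p ∤ #H'` for `H' ≤ Gal(L/k)` when `p ∤ [L : k]`. [folklore] -/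
private theorem not_dvd_card_subgroup' {k : Type} [Field k] (L : IntermediateField k (AlgebraicClosure k))
    [FiniteDimensional k L] [IsGalois k L] {p : ℕ} (hL : ¬ p ∣ Module.finrank k L)
    (H' : Subgroup (L ≃ₐ[k] L)) [Fintype H'] : ¬ p ∣ Fintype.card H' := fun h => by
  apply hL
  rw [← IsGalois.card_aut_eq_finrank]
  refine h.trans ?_
  rw [← Nat.card_eq_fintype_card]
  exact Subgroup.card_subgroup_dvd_card H'

/-- The central form of the saturated inertia condition: `g h′ ∈ I(𝔮)·g·H` for `h′ ∈ ⟨c⟩H`, `c` central in `I(𝔮)`. [folklore] -/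
private theorem saturated_of_central {G : Type*} [Group G] (c : G) (hc : ∀ g : G, g * c = c * g) (H I : Subgroup G)
    (hcI : c ∈ I) (g h' : G) (hh' : h' ∈ Subgroup.zpowers c ⊔ H) : ∃ i ∈ I, ∃ h ∈ H, g * h' = i * g * h := by
  obtain ⟨m, h, hh, rfl⟩ := exists_zpow_mul_of_mem_zpowers_sup' c hc H hh'
  refine ⟨c ^ m, I.zpow_mem hcI m, h, hh, ?_⟩
  have hcomm : g * c ^ m = c ^ m * g := (((commute_iff_eq c g).mpr (hc g).symm).zpow_left m).eq.symm
  rw [← mul_assoc, hcomm]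

/-! ### §1 The record -/

set_option maxHeartbeats 1600000 in
set_option synthInstance.maxHeartbeats 400000 in
/-- **CONDITIONAL U₀ for `396900b1` @ 5 by the μ-road with the rank-equality transfer** — `ord₅ #Ш(E) ≤ ord₅ #Ш_an(E)`
(`MissingUpperBoundAt E 5`) for `E = 396900b1 = [0, 0, 0, −73959375, 244814963750]` (`N = 2²·3⁴·5²·7²`, Kodaira IV* at 5, (t′), `E[5]` with image
`C_ns⁺(5)`), from: the named facts `hKatoA hGZK hmod`; Cremona's `r_an = 0` (`hr`); the `C_ns⁺(ε)` basis data (`e hε he σx σs hσx hσs`); SIX classical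
`μ = 0` hypotheses for the leaves `ℚ(E[5])^H`, `H = ⟨σ̄_x¹², σ̄_s⟩ (= ℚ(x(P)), degree 12), ⟨σ̄_x⁶σ̄_s⟩ (12), ⟨σ̄_x³⟩ (6), ⟨σ̄_x⁶, σ̄_s⟩ (6), ⟨σ̄_x⁶, σ̄_x³σ̄_s⟩ (6),
⟨σ̄_x³, σ̄_s⟩ (3)`; and, IN PLACE OF `μ_5(ℚ(P)) = 0`, the rank equality `#Cl(ℚ(P))[5] = #Cl(ℚ(x(P)))[5]` (`hrank`, numerically `5 = 5`) and
`σ̄_x¹² ∈ I(𝔮)` for the primes `𝔮 ∋ 5` of `ℚ(E[5])` (`hcI`, `e(𝔮|5) = 8`).  KERNEL: `E[5]` irreducible, `Addv`, `SubTprime` (tree, `TameConjAFiveRecords`),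
`5 ∤ [ℚ(E[5]):ℚ]`, `σ̄_x¹²` central.  Per row; CONDITIONAL; nothing booked; BSD is not proved by this.
[cite: Kato2004Asterisque, Thm. 14.5 (3) (p. 236)] [cite: CoatesSujatha2005, Thm. 3.4 (§3)] [cite: Washington1997, §13.3 Prop. 13.23]
[cite: Serre1972, §2.2] [cite: Cremona2006, Table 1 (Cremona label 396900b1)] -/
theorem missingUpperBoundAt_g396900b1_5_of_mu_rankEq
    (hKatoA : Kato2004.rankZero_padicValNat_sha_add_padicValNat_tamagawa_le_of_additive_potGood_of_irreducible_of_fineSelmerDual_fg)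
    (hGZK : rank_eq_analyticRank_of_analyticRank_le_one) (hmod : hasEntireLFunction_rat)
    {W : WeierstrassCurve ℚ} [W.IsElliptic] [W.IsGloballyMinimal] (hWeq : W = (⟨0, 0, 0, (-73959375), 244814963750⟩ : WeierstrassCurve ℚ))
    (hr : W.analyticRank = 0)
    (e : W.geomTorsion (5 : ℕ) ≃+ (Fin 2 → ZMod 5)) {ε : ZMod 5} (hε : ¬ IsSquare ε)
    (he : ∀ σ : absoluteGaloisGroup ℚ, ∃ M ∈ nonsplitCartanNormalizer ε, ∀ P : W.geomTorsion (5 : ℕ), e (σ • P) = M *ᵥ e P)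
    (σx σs : absoluteGaloisGroup ℚ) (hσx : ∀ P : W.geomTorsion (5 : ℕ), e (σx • P) = !![1, ε * (4 - ε); 4 - ε, 1] *ᵥ e P)
    (hσs : ∀ P : W.geomTorsion (5 : ℕ), e (σs • P) = !![1, 0; 0, 4] *ᵥ e P)
    (hrank : Nat.card {d : ClassGroup (𝓞 ↥(fixedField (Subgroup.zpowers (absRestrictNormalHom (W.divisionField 5) σs)))) // d ^ 5 = 1} =
      Nat.card {d : ClassGroup (𝓞 ↥(fixedField (Subgroup.zpowers (absRestrictNormalHom (W.divisionField 5) σx ^ 12) ⊔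
        Subgroup.zpowers (absRestrictNormalHom (W.divisionField 5) σs)))) // d ^ 5 = 1})
    (hcI : ∀ (𝔮 : Ideal (𝓞 ↥(W.divisionField 5))) [𝔮.IsMaximal], ((5 : ℕ) : 𝓞 ↥(W.divisionField 5)) ∈ 𝔮 →
      absRestrictNormalHom (W.divisionField 5) σx ^ 12 ∈ 𝔮.inertia _)
    (hμB₁ : ∀ κE : ZpExtension ↥(fixedField (Subgroup.zpowers (absRestrictNormalHom (W.divisionField 5) σx ^ 12) ⊔
        Subgroup.zpowers (absRestrictNormalHom (W.divisionField 5) σs))) 5,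
      κE.IsCyclotomic → ClassicalMuVanishes κE)
    (hμB₁' : ∀ κE : ZpExtension ↥(fixedField (Subgroup.zpowers (absRestrictNormalHom (W.divisionField 5) σx ^ 6 *
        absRestrictNormalHom (W.divisionField 5) σs))) 5,
      κE.IsCyclotomic → ClassicalMuVanishes κE)
    (hμS : ∀ κE : ZpExtension ↥(fixedField (Subgroup.zpowers (absRestrictNormalHom (W.divisionField 5) σx ^ 3))) 5,
      κE.IsCyclotomic → ClassicalMuVanishes κE)
    (hμB₂ : ∀ κE : ZpExtension ↥(fixedField (Subgroup.zpowers (absRestrictNormalHom (W.divisionField 5) σx ^ 6) ⊔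
        Subgroup.zpowers (absRestrictNormalHom (W.divisionField 5) σs))) 5,
      κE.IsCyclotomic → ClassicalMuVanishes κE)
    (hμB₂' : ∀ κE : ZpExtension ↥(fixedField (Subgroup.zpowers (absRestrictNormalHom (W.divisionField 5) σx ^ 6) ⊔
        Subgroup.zpowers (absRestrictNormalHom (W.divisionField 5) σx ^ 3 * absRestrictNormalHom (W.divisionField 5) σs))) 5,
      κE.IsCyclotomic → ClassicalMuVanishes κE)
    (hμB₃ : ∀ κE : ZpExtension ↥(fixedField (Subgroup.zpowers (absRestrictNormalHom (W.divisionField 5) σx ^ 3) ⊔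
        Subgroup.zpowers (absRestrictNormalHom (W.divisionField 5) σs))) 5,
      κE.IsCyclotomic → ClassicalMuVanishes κE) :
    MissingUpperBoundAt W 5 := by
  haveI : Fact (Nat.Prime 5) := ⟨by norm_num⟩
  have hε' := eq_two_or_three_of_not_isSquare' hε
  -- the faithful matrix representation of `Gal(ℚ(E[5])/ℚ)` in the basis `e`
  obtain ⟨ρ, hρ, hρe⟩ := exists_matrixRep_divisionField W 5 e
  have hmat : ∀ (σ : absoluteGaloisGroup ℚ) (M : Matrix (Fin 2) (Fin 2) (ZMod 5)),
      (∀ P, e (σ • P) = M *ᵥ e P) → ρ (absRestrictNormalHom _ σ) = M :=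
    fun σ M hM => matrix_eq_of_forall_mulVec' e fun P => by rw [← hρe, hM]
  have hπ := absRestrictNormalHom_surjective' (W.divisionField 5)
  have himg : ∀ g, ρ g ∈ nonsplitCartanNormalizer ε := fun g => by
    obtain ⟨σ, rfl⟩ := hπ g
    obtain ⟨M, hM, hMe⟩ := he σ
    rw [hmat σ M hMe]
    exact hM
  -- `5 ∤ [ℚ(E[5]) : ℚ]`: every element of the Galois group has order dividing 24
  have hL₀ := not_dvd_finrank_of_forall_pow_24 (W.divisionField 5) (p := 5) (by norm_num) (by norm_num)
    (fun g => hρ (by rw [map_pow, map_one]; exact pow_24_eq_one_of_mem' hε' (himg g)))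
  -- `σ̄_x¹² = −1` is central
  have hx12 : ρ (absRestrictNormalHom _ σx ^ 12) = -1 := by
    rw [map_pow, hmat σx _ hσx]; exact R_pow_twelve hε'
  have hc : ∀ g, g * absRestrictNormalHom _ σx ^ 12 = absRestrictNormalHom _ σx ^ 12 * g := fun g =>
    hρ (by rw [map_mul, map_mul, hx12, mul_neg_one, neg_one_mul])
  -- `μ_5(ℚ(P)) = 0` by the rank-equality transfer over the cyclotomic `ℤ_5`-extension of `ℚ`
  haveI : NumberField ↥(W.divisionField 5) := NumberField.mk
  have hμP : ∀ κE : ZpExtension ↥(fixedField (Subgroup.zpowers (absRestrictNormalHom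
      (W.divisionField 5) σs))) 5,
      κE.IsCyclotomic → ClassicalMuVanishes κE := by
    intro κE hκE
    obtain ⟨κ, hκ⟩ := exists_cyclotomicZpExtension_holds ℚ 5
    haveI := fun m => κ.isGalois_layer_holds m
    haveI := fun m => κ.finiteDimensional_layer_holds m
    haveI hNF : ∀ m, NumberField ↥(W.divisionField 5 ⊔ κ.layer m) :=
      fun m => NumberField.of_module_finite ℚ _
    have hram := Literature.NumberTheory.NumberFields.EquivariantIwasawaLemma.exists_isMaximal_inertia_sup_kerSubgroup_eq_top_of_isCyclotomic hκ
    haveI : Fintype ↥(Subgroup.zpowers (absRestrictNormalHom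
      (W.divisionField 5) σs)) := Fintype.ofFinite _
    haveI : Fintype ↥(Subgroup.zpowers (absRestrictNormalHom
        (W.divisionField 5) σx ^ 12) ⊔
      Subgroup.zpowers (absRestrictNormalHom (W.divisionField 5) σs)) :=
      Fintype.ofFinite _
    have hpH' := not_dvd_card_subgroup' _ hL₀ (Subgroup.zpowers (absRestrictNormalHom
        (W.divisionField 5) σx ^ 12) ⊔
      Subgroup.zpowers (absRestrictNormalHom (W.divisionField 5) σs))
    exact RankEqualityTransfer.classicalMuVanishes_of_isCyclotomic_fixedField_of_saturated (by norm_num) κ hκ _ hL₀ hram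
      (Subgroup.zpowers (absRestrictNormalHom _ σs)) _ le_sup_right hpH' hrank
      (fun 𝔮 _ h𝔮 g h' hh' => saturated_of_central _ hc _ _ (hcI 𝔮 h𝔮) g h' hh') (hμB₁) κE hκE
  subst hWeq
  exact CartanMuRoadDoorsTprimeFive.missingUpperBoundAt_five_tame_of_nonsplitCartanBasis_of_mu _ hKatoA hGZK hmod
    CoatesSujatha2005.thm34_fineSelmerDual_moduleFinite_of_classicalMuVanishes_divisionField_holds hr
    TameConjAFiveRecords.addv_g396900b1_5 TameConjAFiveRecords.subTprime_g396900b1_5 TameConjAFiveRecords.irr_g396900b1_5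
    e hε he σx σs hσx hσs hμP hμB₁ hμB₁' hμS hμB₂ hμB₂' hμB₃

end Summit.BirchSwinnertonDyer.BirchSwinnertonDyer.Theorems.TameRankEqRecords

end
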